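import Summits.CriticalPhenomena.PercolationContinuityZ3.Theorems.SahiBoxTP2HilbertReindex
import Summits.CriticalPhenomena.PercolationContinuityZ3.Theorems.SahiBoxTP2RealSequences
import Summits.CriticalPhenomena.PercolationContinuityZ3.Theorems.SahiIsingGibbsStates
import Literature.Probability.Percolation.PositiveAssociation

/-!
# Box-TP₂ laws are positively associated (bridge to `Literature.Probability.Percolation.IsPositivelyAssociated`)

Support file of the Sahi cell (`prim-sahi`, typer seat, generation 14; `--supports stmt-CriticalPhenomena-4575`).
Theorems only (no definitions, no named facts, no sorries).

The cell's unconditional order-2 layer ("box-TP₂ ⟹ FKG inequality for all measurable monotone functionals",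
generations 11–13) is restated as the tree's PROPERTY `Literature.Probability.Percolation.IsPositivelyAssociated`
(`μ A · μ B ≤ μ (A ∩ B)` for measurable increasing events), so that the literature seat's positive-association API
(square-root trick, products of many events, monotone images, decreasing events, weak limits and marginals of PA
laws — `PositiveAssociation*.lean`, `PositiveAssociationLimits.lean`) applies verbatim to every box-TP₂ law of the
cell — singular laws on `Q_d`, `ℝ^d`, `[0,1]^ℕ`, `ι → [0,1]`, `ℝ^ℕ`, `{−1,+1}^ι`, hence (this generation) to all weak
limits of ferromagnetic Gibbs measures and to all continuous log-supermodular tilts: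

* `IsBoxTP2.isPositivelyAssociated_cube`, `_real`, `_hilbert`, `_hilbert_countable`, `_realSeq`, `_spinConfig`.

No sorries, no new axioms.
-/

noncomputable section

namespace Summit.CriticalPhenomena.PercolationContinuityZ3.Theorems.SahiBoxTP2

open MeasureTheory Set Filter Topology Function Literature.Combinatorics.Sahi2008
open Literature.Probability.Percolation (IsPositivelyAssociated isPositivelyAssociated_of_real)
open scoped ENNReal NNReal unitInterval

/-! ### From the FKG inequality for indicator pairs to positive association -/

/-- **Positive association from the covariance inequality for indicators of increasing events.** [folklore] -/
theorem isPositivelyAssociated_of_indicator {Ω : Type*} [MeasurableSpace Ω] [Preorder Ω] (μ : Measure Ω)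
    [IsFiniteMeasure μ]
    (h : ∀ A B : Set Ω, IsUpperSet A → IsUpperSet B → MeasurableSet A → MeasurableSet B →
      (∫ x, A.indicator (1 : Ω → ℝ) x ∂μ) * (∫ x, B.indicator (1 : Ω → ℝ) x ∂μ) ≤
        ∫ x, A.indicator (1 : Ω → ℝ) x * B.indicator (1 : Ω → ℝ) x ∂μ) :
    IsPositivelyAssociated μ := by
  refine isPositivelyAssociated_of_real fun A B hA hB hAm hBm => ?_
  have key := h A B hA hB hAm hBm
  have e : (fun x => A.indicator (1 : Ω → ℝ) x * B.indicator (1 : Ω → ℝ) x) = (A ∩ B).indicator (1 : Ω → ℝ) := by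
    funext x
    rw [inter_indicator_one]
    rfl
  rw [e, integral_indicator_one hAm, integral_indicator_one hBm, integral_indicator_one (hAm.inter hBm)] at key
  exact key

/-- The indicator of an increasing event is monotone, measurable, in `[0,1]` (plumbing). [folklore] -/
theorem indicator_one_props {Ω : Type*} [MeasurableSpace Ω] [Preorder Ω] {A : Set Ω} (hA : IsUpperSet A)
    (hAm : MeasurableSet A) :
    Monotone (A.indicator (1 : Ω → ℝ)) ∧ Measurable (A.indicator (1 : Ω → ℝ)) ∧
      (∀ x, 0 ≤ A.indicator (1 : Ω → ℝ) x) ∧ ∀ x, A.indicator (1 : Ω → ℝ) x ≤ 1 := by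
  refine ⟨fun a b hab => ?_, measurable_one.indicator hAm, fun x => indicator_nonneg (fun _ _ => zero_le_one) x,
    fun x => indicator_le_self' (fun _ _ => zero_le_one) x⟩
  by_cases ha : a ∈ A
  · rw [indicator_of_mem ha, indicator_of_mem (hA hab ha), Pi.one_apply, Pi.one_apply]
  · rw [indicator_of_notMem ha]
    exact indicator_nonneg (fun _ _ => zero_le_one) b

/-! ### Box-TP₂ laws are positively associated -/

variable {d : ℕ} {ι : Type*}

/-- **Box-TP₂ probability measures on `Q_d = [0,1]^d` are positively associated.** [this work] -/
theorem IsBoxTP2.isPositivelyAssociated_cube (μ : Measure (Fin d → I)) [IsProbabilityMeasure μ] (hμ : IsBoxTP2 μ) :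
    IsPositivelyAssociated μ := by
  refine isPositivelyAssociated_of_indicator μ fun A B hA hB hAm hBm => ?_
  obtain ⟨hAmo, hAme, hA0, -⟩ := indicator_one_props hA hAm
  obtain ⟨hBmo, hBme, hB0, -⟩ := indicator_one_props hB hBm
  have h := msahiE_nonneg_of_isBoxTP2_of_order_le_two le_rfl μ hμ ![A.indicator 1, B.indicator 1]
    (fun i => by fin_cases i <;> assumption) (fun i => by fin_cases i <;> assumption)
    (fun i => by fin_cases i <;> assumption)
  rw [msahiE_two] at h
  linarith

/-- **Box-TP₂ probability measures on `ℝ^d` are positively associated.** [this work] -/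
theorem IsBoxTP2.isPositivelyAssociated_real (ν : Measure (Fin d → ℝ)) [IsProbabilityMeasure ν] (hν : IsBoxTP2 ν) :
    IsPositivelyAssociated ν := by
  refine isPositivelyAssociated_of_indicator ν fun A B hA hB hAm hBm => ?_
  obtain ⟨hAmo, hAme, hA0, hA1⟩ := indicator_one_props hA hAm
  obtain ⟨hBmo, hBme, hB0, hB1⟩ := indicator_one_props hB hBm
  have h := msahiE_nonneg_of_isBoxTP2_real_of_order_le_two le_rfl ν hν ![A.indicator 1, B.indicator 1]
    (fun i => by fin_cases i <;> assumption) (fun i => by fin_cases i <;> assumption) (M := 1)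
    (fun i => by fin_cases i <;> assumption) (fun i => by fin_cases i <;> assumption)
  rw [msahiE_two] at h
  linarith

/-- **Box-TP₂ probability measures on the Hilbert cube `[0,1]^ℕ` are positively associated.** [this work] -/
theorem IsBoxTP2.isPositivelyAssociated_hilbert (μ : Measure (ℕ → I)) [IsProbabilityMeasure μ] (hμ : IsBoxTP2 μ) :
    IsPositivelyAssociated μ := by
  refine isPositivelyAssociated_of_indicator μ fun A B hA hB hAm hBm => ?_
  obtain ⟨hAmo, hAme, hA0, -⟩ := indicator_one_props hA hAm
  obtain ⟨hBmo, hBme, hB0, -⟩ := indicator_one_props hB hBm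
  exact integral_mul_integral_le_of_isBoxTP2_hilbert μ hμ hAme hBme hA0 hB0 hAmo hBmo

/-- **Box-TP₂ probability measures on `ι → [0,1]` (`ι ≃ ℕ`) are positively associated.** [this work] -/
theorem IsBoxTP2.isPositivelyAssociated_hilbert_countable (e : ι ≃ ℕ) (μ : Measure (ι → I))
    [IsProbabilityMeasure μ] (hμ : IsBoxTP2 μ) : IsPositivelyAssociated μ := by
  refine isPositivelyAssociated_of_indicator μ fun A B hA hB hAm hBm => ?_
  obtain ⟨hAmo, hAme, hA0, -⟩ := indicator_one_props hA hAm
  obtain ⟨hBmo, hBme, hB0, -⟩ := indicator_one_props hB hBm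
  exact integral_mul_integral_le_of_isBoxTP2_countable e μ hμ hAme hBme hA0 hB0 hAmo hBmo

/-- **Box-TP₂ probability measures on `ℝ^ℕ` are positively associated.** [this work] -/
theorem IsBoxTP2.isPositivelyAssociated_realSeq (ν : Measure (ℕ → ℝ)) [IsProbabilityMeasure ν]
    (hν : IsBoxTP2 ν) : IsPositivelyAssociated ν := by
  refine isPositivelyAssociated_of_indicator ν fun A B hA hB hAm hBm => ?_
  obtain ⟨hAmo, hAme, hA0, hA1⟩ := indicator_one_props hA hAm
  obtain ⟨hBmo, hBme, hB0, hB1⟩ := indicator_one_props hB hBm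
  exact integral_mul_integral_le_of_isBoxTP2_realSeq ν hν hAme hBme hA0 hB0 hA1 hB1 hAmo hBmo

/-- **Box-TP₂ probability measures on `{−1,+1}^ι` (`ι` countably infinite) are positively associated** — e.g. the
Ising states of generation 13 and all weak limits of ferromagnetic Gibbs measures. [this work] -/
theorem IsBoxTP2.isPositivelyAssociated_spinConfig [Countable ι] [Infinite ι] (μ : Measure (ι → ℤˣ))
    [IsProbabilityMeasure μ] (hμ : IsBoxTP2 μ) : IsPositivelyAssociated μ := by
  refine isPositivelyAssociated_of_indicator μ fun A B hA hB hAm hBm => ?_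
  obtain ⟨hAmo, hAme, hA0, -⟩ := indicator_one_props hA hAm
  obtain ⟨hBmo, hBme, hB0, -⟩ := indicator_one_props hB hBm
  exact integral_mul_integral_le_of_isBoxTP2_spinConfig μ hμ hAme hBme hA0 hB0 hAmo hBmo

end Summit.CriticalPhenomena.PercolationContinuityZ3.Theorems.SahiBoxTP2
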